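import Literature.AnabelianGeometry.AbsoluteAnabelian.UnitKummerCyclotomeJunctionTCGCanonical
import Literature.AnabelianGeometry.AbsoluteAnabelian.GaloisCyclotomeReciprocityTwist
import HarnessLib

/-!
# [AbsTopIII] Prop 3.3 (i) clause (c), `TLG`: the presented cyclotome class sees the junction datum
# EXACTLY modulo `±1` (twist criterion)

S. Mochizuki, *Topics in absolute anabelian geometry III*, §3, Prop. 3.3 (i) p. 73 (bib key `MochizukiAbsTopIII2015`):
for `T = TLG` «the natural isomorphism `μ_Ẑ(M) ⥲ μ_Ẑ(G)` [cf. Remark 3.2.1] is only determined up to a `{±1}`-multiple»;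
Rmk. 3.2.1 p. 73: THE natural `μ_Ẑ(M_TM) ⥲ μ_Ẑ(G)` is pinned «by imposing the condition of “compatibility with the natural
isomorphism of Corollary 1.10, (a)”».

abc-iut cell, layer L4, node AbsTopIII:Prop3.3(i), row «P33i-TLG-TWIST-CRITERION» (seat abc-iut-w4-d009 gen 5; the
consumer-side half of abc-iut-w6-d022's row «RECIPROCITY-NORMALISE»).  PROOF-ONLY, 0 defs.  State of the tree:
`UnitKummerCyclotomeJunction.lean` (p432997) composes the cyclotome class of the presented unit Kummer theory with the
identification `Λ(k̄ˣ) ≃* μ_Ẑ(G_k)` built on CHOSEN torsion reciprocity data (`MLFClosure.reciprocityData`,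
`Classical.choice`); `GaloisCyclotomeReciprocityTwist.lean` (p433978, abc-iut-w6-d022) records that (T1)–(T4) do not pin the
datum (the inverse twist is again a datum); `UnitKummerCyclotomeJunctionTCGCanonical.lean` (p434641) shows that for
`T = TCG` the choice is absorbed.  For `T = TLG` the class `{g e, g e ∘ inv}` DOES depend on the identification `g` — this
file proves EXACTLY how much:

* `UnitKummerTheory.inv_trans_mem_cycIsoClass` — every cyclotome class is closed under PRE-composition with inversion
  (all `T`: the `TLG` guard of `cycIsoClass_full` allows `inv`);
* `UnitKummerTheory.mapCyclotome_cycIsoClass_inv_trans` — `(U.mapCyclotome (inv ≫ g)).cycIsoClass =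
  (U.mapCyclotome g).cycIsoClass` (all `T`): re-targeting by the inverse twist of `g` does not change the class;
* **`UnitKummerTheory.mapCyclotome_cycIsoClass_eq_iff_of_TLG`** — for `T = TLG`:
  `(U.mapCyclotome g).cycIsoClass = (U.mapCyclotome g').cycIsoClass ↔ (g' = g ∨ g' = inv ≫ g)` — the presented `TLG`
  class sees the target identification EXACTLY modulo `{±1}`;
* `TorsionReciprocityData.muZhatEquiv_apply_of_inv_twist` / `muZhatEquiv_eq_of_inv_twist` — the `Ẑ`-level form of
  abc-iut-w6-d022's torsion-level `coe_equiv_of_inv_twist`: the inverse twist INVERTS `μ_Ẑ(G_k) ≃* Λ(k̄ˣ)`;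
* **`GaloisMonoidPair.TLGPresentation.mapCyclotome_cycIsoClass_eq_of_inv_twist`** — two data related by the inverse twist
  give the SAME presented `TLG` class against `μ_Ẑ(G_k)`;
* **`GaloisMonoidPair.TLGPresentation.unitKummerTheoryMuZhat_cycIsoClass_eq_iff`** — the class of
  `π.unitKummerTheoryMuZhat` (chosen datum `D₀`) equals the class built from a datum `D` IFF
  `D.muZhatEquiv = D₀.muZhatEquiv` or `D.muZhatEquiv = D₀.muZhatEquiv ≫ inv`: the TYPED form of the residual
  «modulo the Rmk. 3.2.1 normalisation of the reciprocity datum» — a normalisation unique up to the inverse twist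
  suffices for `TLG`, and nothing weaker does.

HONEST FRAMING: classical bookkeeping (LCFT + Kummer theory at OUR model objects); the Rmk. 3.2.1 normalisation itself
(`H²`-compatibility with Cor. 1.10 (a)) is NOT constructed here; nothing here bears on [IUTchIII] Cor. 3.12; no side taken.
-/

noncomputable section

namespace Literature.AnabelianGeometry.AbsoluteAnabelian

universe u

/-! ### Inversion commutes with every isomorphism of commutative groups -/

/-- `inv ≫ e = e ≫ inv` for an isomorphism of commutative groups (`e (x⁻¹) = (e x)⁻¹`).
[cite: MochizukiAbsTopIII2015, Proposition 3.3 (i) p.73] -/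
theorem MulEquiv.inv_trans_eq_trans_inv {A : Type*} {B : Type*} [CommGroup A] [CommGroup B] (e : A ≃* B) :
    (MulEquiv.inv A).trans e = e.trans (MulEquiv.inv B) :=
  MulEquiv.ext fun x => by simp

/-- `inv ≫ inv ≫ e = e`. [cite: MochizukiAbsTopIII2015, Proposition 3.3 (i) p.73] -/
theorem MulEquiv.inv_trans_inv_trans {A : Type*} {B : Type*} [CommGroup A] [CommGroup B] (e : A ≃* B) :
    (MulEquiv.inv A).trans ((MulEquiv.inv A).trans e) = e :=
  MulEquiv.ext fun x => by simp

namespace UnitKummerTheory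

variable {T : PairType} {P : GaloisMonoidPair.{u}}

/-! ### Every cyclotome class is closed under the inverse twist -/

/-- A cyclotome class (any `T`) is closed under PRE-composition with inversion of `μ_Ẑ(M)`: the `TLG` guard of
`cycIsoClass_full` allows `u = inv`. [cite: MochizukiAbsTopIII2015, Proposition 3.3 (i) p.73] -/
theorem inv_trans_mem_cycIsoClass (U : UnitKummerTheory T P) {e : cyclotome P.M ≃* U.muG} (he : e ∈ U.cycIsoClass) :
    (MulEquiv.inv (cyclotome P.M)).trans e ∈ U.cycIsoClass := by
  obtain ⟨e₂, he₂, hcomp⟩ := U.cycIsoClass_full e he (MulEquiv.inv (cyclotome P.M)) (fun _ => Or.inr rfl)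
  have heq : e₂ = (MulEquiv.inv (cyclotome P.M)).trans e := MulEquiv.ext fun ζ => by
    rw [hcomp, MulEquiv.trans_apply]
  exact heq ▸ he₂

/-- … equivalently under POST-composition with inversion of the target.
[cite: MochizukiAbsTopIII2015, Proposition 3.3 (i) p.73] -/
theorem trans_inv_mem_cycIsoClass (U : UnitKummerTheory T P) {e : cyclotome P.M ≃* U.muG} (he : e ∈ U.cycIsoClass) :
    e.trans (MulEquiv.inv U.muG) ∈ U.cycIsoClass := by
  rw [← MulEquiv.inv_trans_eq_trans_inv]
  exact U.inv_trans_mem_cycIsoClass he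

/-- **Re-targeting by the inverse twist does not change the class** (any `T`):
`(U.mapCyclotome (inv ≫ g)).cycIsoClass = (U.mapCyclotome g).cycIsoClass`.
[cite: MochizukiAbsTopIII2015, Proposition 3.3 (i) p.73] -/
theorem mapCyclotome_cycIsoClass_inv_trans (U : UnitKummerTheory T P) {N : Type u} [CommGroup N] (g : U.muG ≃* N) :
    (U.mapCyclotome ((MulEquiv.inv U.muG).trans g)).cycIsoClass = (U.mapCyclotome g).cycIsoClass := by
  apply Set.Subset.antisymm
  · rintro _ ⟨e, he, rfl⟩
    exact ⟨e.trans (MulEquiv.inv U.muG), U.trans_inv_mem_cycIsoClass he, MulEquiv.ext fun ζ => rfl⟩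
  · rintro _ ⟨e, he, rfl⟩
    refine ⟨e.trans (MulEquiv.inv U.muG), U.trans_inv_mem_cycIsoClass he, MulEquiv.ext fun ζ => ?_⟩
    change g (((e ζ)⁻¹)⁻¹) = g (e ζ)
    rw [inv_inv]

/-- The same with the twist written on the target: `(U.mapCyclotome (g ≫ inv)).cycIsoClass = (U.mapCyclotome g).cycIsoClass`.
[cite: MochizukiAbsTopIII2015, Proposition 3.3 (i) p.73] -/
theorem mapCyclotome_cycIsoClass_trans_inv (U : UnitKummerTheory T P) {N : Type u} [CommGroup N] (g : U.muG ≃* N) :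
    (U.mapCyclotome (g.trans (MulEquiv.inv N))).cycIsoClass = (U.mapCyclotome g).cycIsoClass := by
  rw [← MulEquiv.inv_trans_eq_trans_inv]
  exact U.mapCyclotome_cycIsoClass_inv_trans g

/-! ### `TLG`: the class sees the target identification exactly modulo `±1` -/

/-- For `T = TLG`, if `e₀ ≫ g'` lies in the class re-targeted along `g` (some `e₀` in the class), then `g' = g` or
`g' = inv ≫ g`. [cite: MochizukiAbsTopIII2015, Proposition 3.3 (i) p.73] -/
theorem eq_or_eq_inv_trans_of_TLG (U : UnitKummerTheory .TLG P) {N : Type u} [CommGroup N] (g g' : U.muG ≃* N)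
    {e₀ : cyclotome P.M ≃* U.muG} (he₀ : e₀ ∈ U.cycIsoClass)
    (h : e₀.trans g' ∈ (U.mapCyclotome g).cycIsoClass) : g' = g ∨ g' = (MulEquiv.inv U.muG).trans g := by
  obtain ⟨e, he, hcomp⟩ := h
  obtain ⟨u, hu, hu'⟩ := U.cycIsoClass_torsor e₀ he₀ e he
  -- `e = e₀ ∘ u` with `u ∈ {id, inv}`, and `e ≫ g = e₀ ≫ g'`
  have happ : ∀ ζ, g' (e₀ ζ) = g (e₀ (u ζ)) := fun ζ => by
    have := MulEquiv.congr_fun hcomp ζ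
    rw [MulEquiv.trans_apply, MulEquiv.trans_apply, hu'] at this
    exact this.symm
  rcases hu rfl with rfl | rfl
  · left
    refine MulEquiv.ext fun x => ?_
    have := happ (e₀.symm x)
    rwa [MulEquiv.refl_apply, MulEquiv.apply_symm_apply] at this
  · right
    refine MulEquiv.ext fun x => ?_
    have := happ (e₀.symm x)
    rw [MulEquiv.inv_apply, map_inv, MulEquiv.apply_symm_apply] at this
    rw [this, MulEquiv.trans_apply, MulEquiv.inv_apply]

/-- **Twist criterion, `T = TLG`**: two target identifications `g, g' : μ ≃* N` give the same presented class iff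
`g' = g` or `g' = inv ≫ g` — the `TLG` class is determined by, and determines, the identification up to `{±1}`.
[cite: MochizukiAbsTopIII2015, Proposition 3.3 (i) p.73] -/
theorem mapCyclotome_cycIsoClass_eq_iff_of_TLG (U : UnitKummerTheory .TLG P) {N : Type u} [CommGroup N]
    (g g' : U.muG ≃* N) :
    (U.mapCyclotome g).cycIsoClass = (U.mapCyclotome g').cycIsoClass ↔
      (g' = g ∨ g' = (MulEquiv.inv U.muG).trans g) := by
  constructor
  · intro h
    obtain ⟨e₀, he₀⟩ := U.cycIsoClass_nonempty
    exact U.eq_or_eq_inv_trans_of_TLG g g' he₀ (h ▸ U.trans_mem_mapCyclotome_cycIsoClass g' he₀)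
  · rintro (rfl | rfl)
    · rfl
    · exact (U.mapCyclotome_cycIsoClass_inv_trans g).symm

/-- **Sharpness, `T = TLG`**: re-targeting along a `g'` that is NEITHER `g` NOR its inverse twist CHANGES the class.
[cite: MochizukiAbsTopIII2015, Proposition 3.3 (i) p.73] -/
theorem mapCyclotome_cycIsoClass_ne_of_TLG (U : UnitKummerTheory .TLG P) {N : Type u} [CommGroup N]
    {g g' : U.muG ≃* N} (h₁ : g' ≠ g) (h₂ : g' ≠ (MulEquiv.inv U.muG).trans g) :
    (U.mapCyclotome g).cycIsoClass ≠ (U.mapCyclotome g').cycIsoClass := fun h =>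
  ((U.mapCyclotome_cycIsoClass_eq_iff_of_TLG g g').mp h).elim h₁ h₂

/-- **Twist criterion, `T = TLG`, twist on the target**: `(U.mapCyclotome g).cycIsoClass = (U.mapCyclotome g').cycIsoClass ↔
(g' = g ∨ g' = g ≫ inv)`. [cite: MochizukiAbsTopIII2015, Proposition 3.3 (i) p.73] -/
theorem mapCyclotome_cycIsoClass_eq_iff_of_TLG' (U : UnitKummerTheory .TLG P) {N : Type u} [CommGroup N]
    (g g' : U.muG ≃* N) :
    (U.mapCyclotome g).cycIsoClass = (U.mapCyclotome g').cycIsoClass ↔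
      (g' = g ∨ g' = g.trans (MulEquiv.inv N)) := by
  rw [← MulEquiv.inv_trans_eq_trans_inv]
  exact U.mapCyclotome_cycIsoClass_eq_iff_of_TLG g g'

end UnitKummerTheory

/-! ### Cancelling an isomorphism in a composite -/

/-- Left cancellation of an isomorphism: `c ≫ e₁ = c ≫ e₂ ↔ e₁ = e₂`. [cite: MochizukiAbsTopIII2015, Proposition 3.3 (i) p.73] -/
theorem MulEquiv.trans_cancel_left {A : Type*} {B : Type*} {C : Type*} [Mul A] [Mul B] [Mul C] (c : A ≃* B)
    {e₁ e₂ : B ≃* C} : c.trans e₁ = c.trans e₂ ↔ e₁ = e₂ :=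
  ⟨fun h => MulEquiv.ext fun y => by
    have := MulEquiv.congr_fun h (c.symm y)
    rwa [MulEquiv.trans_apply, MulEquiv.trans_apply, MulEquiv.apply_symm_apply] at this,
   fun h => h ▸ rfl⟩

/-- `e₁.symm = e₂.symm ↔ e₁ = e₂`. [cite: MochizukiAbsTopIII2015, Proposition 3.3 (i) p.73] -/
theorem MulEquiv.symm_inj_iff {A : Type*} {B : Type*} [Mul A] [Mul B] {e₁ e₂ : A ≃* B} :
    e₁.symm = e₂.symm ↔ e₁ = e₂ :=
  MulEquiv.symm_bijective.injective.eq_iff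

/-! ### The inverse twist of torsion reciprocity data INVERTS `μ_Ẑ(G_k) ≃* Λ(k̄ˣ)` -/

namespace TorsionReciprocityData

variable {k : Type u} [Field k] [CharZero k]

/-- Torsion reciprocity data are determined by their maps `θ_U` (the other fields are propositions).
[cite: MochizukiAbsAnab2004, Prop 1.2.1 (vi) p.10] -/
theorem eq_of_θ_eq {D D' : TorsionReciprocityData k}
    (h : ∀ (U : OpenSubgroup (Field.absoluteGaloisGroup k))
      (x : abelianizationTorsion (U : Subgroup (Field.absoluteGaloisGroup k))), D'.θ U x = D.θ U x) : D' = D := by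
  obtain ⟨θ', _, _, _, _⟩ := D'
  obtain ⟨θ, _, _, _, _⟩ := D
  have hθ : θ' = θ := funext fun U => MonoidHom.ext (h U)
  subst hθ
  rfl

/-- **`Ẑ`-level inverse twist**: if `D'` is the inverse twist of `D` (`θ'_U = θ_U⁻¹`), then
`D'.muZhatEquiv ζ = (D.muZhatEquiv ζ)⁻¹` — the `Λ(−)`-image of abc-iut-w6-d022's torsion-level `coe_equiv_of_inv_twist`.
[cite: MochizukiAbsTopIII2015, Remark 3.2.1 p.73] -/
theorem muZhatEquiv_apply_of_inv_twist {D D' : TorsionReciprocityData k}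
    (h : ∀ (U : OpenSubgroup (Field.absoluteGaloisGroup k))
      (x : abelianizationTorsion (U : Subgroup (Field.absoluteGaloisGroup k))), D'.θ U x = (D.θ U x)⁻¹)
    (ζ : muZhat (Field.absoluteGaloisGroup k)) : D'.muZhatEquiv ζ = (D.muZhatEquiv ζ)⁻¹ := by
  apply Subtype.ext
  funext n
  rw [muZhatEquiv_apply_coe, Subgroup.coe_inv, Pi.inv_apply, muZhatEquiv_apply_coe]
  exact coe_equiv_of_inv_twist h _

/-- **`Ẑ`-level inverse twist, as isomorphisms**: `D'.muZhatEquiv = D.muZhatEquiv ≫ inv`.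
[cite: MochizukiAbsTopIII2015, Remark 3.2.1 p.73] -/
theorem muZhatEquiv_eq_of_inv_twist {D D' : TorsionReciprocityData k}
    (h : ∀ (U : OpenSubgroup (Field.absoluteGaloisGroup k))
      (x : abelianizationTorsion (U : Subgroup (Field.absoluteGaloisGroup k))), D'.θ U x = (D.θ U x)⁻¹) :
    D'.muZhatEquiv = D.muZhatEquiv.trans (MulEquiv.inv _) :=
  MulEquiv.ext fun ζ => by rw [muZhatEquiv_apply_of_inv_twist h, MulEquiv.trans_apply, MulEquiv.inv_apply]

/-- For ANY `e : A ≃* B` of commutative groups: `(e ≫ inv).symm = inv ≫ e.symm`.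
[cite: MochizukiAbsTopIII2015, Remark 3.2.1 p.73] -/
theorem _root_.Literature.AnabelianGeometry.AbsoluteAnabelian.MulEquiv.trans_inv_symm {A : Type*} {B : Type*}
    [CommGroup A] [CommGroup B] (e : A ≃* B) :
    (e.trans (MulEquiv.inv B)).symm = (MulEquiv.inv B).trans e.symm :=
  MulEquiv.ext fun _ => rfl

/-- … hence `D'.muZhatEquiv.symm = inv ≫ D.muZhatEquiv.symm` (the identification `Λ(k̄ˣ) ≃* μ_Ẑ(G_k)` used by the
junction is PRE-composed with inversion). [cite: MochizukiAbsTopIII2015, Remark 3.2.1 p.73] -/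
theorem muZhatEquiv_symm_eq_of_inv_twist {D D' : TorsionReciprocityData k}
    (h : ∀ (U : OpenSubgroup (Field.absoluteGaloisGroup k))
      (x : abelianizationTorsion (U : Subgroup (Field.absoluteGaloisGroup k))), D'.θ U x = (D.θ U x)⁻¹) :
    D'.muZhatEquiv.symm = (MulEquiv.inv _).trans D.muZhatEquiv.symm := by
  rw [muZhatEquiv_eq_of_inv_twist h]
  exact MulEquiv.trans_inv_symm _

end TorsionReciprocityData

/-! ### The presented `TLG` class against `μ_Ẑ(G_k)`: dependence on the reciprocity datum, exactly -/

namespace GaloisMonoidPair.TLGPresentation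

variable {P : GaloisMonoidPair.{0}} (π : P.TLGPresentation)

/- ELABORATION NOTE (for consumers).  Equalities between the classes of two re-targetings
`π.unitKummerTheory.mapCyclotome (… D …)` / `(… D' …)` are stated as `@Eq (Set (μ_Ẑ(M) ≃* μ_Ẑ(G_k))) lhs rhs`, i.e. with the
common type given FIRST.  Written `lhs = rhs`, the elaborator infers the two types `Set (μ_Ẑ(M) ≃* (….mapCyclotome gᵢ).muG)`
and unifies them by first trying `D.muZhatEquiv =?= D'.muZhatEquiv`, which unfolds the whole direct-limit construction before
failing (minutes, then time-out); with the type given first both sides reduce to `muZhat G_k` at once.  The statements ARE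
ordinary equations of sets (`rw`, `▸`, `Set.ext_iff` apply as usual). -/

/-- `π.unitKummerTheoryMuZhat` IS the re-targeting along the junction built from the CHOSEN datum `π.C.reciprocityData`.
[cite: MochizukiAbsTopIII2015, Proposition 3.3 (i) p.73] -/
theorem unitKummerTheoryMuZhat_eq_mapCyclotome :
    π.unitKummerTheoryMuZhat = π.unitKummerTheory.mapCyclotome
      ((MonoidKummerTheory.cyclotomeCongr π.C.closureMulEquivAlgClosure).trans π.C.reciprocityData.muZhatEquiv.symm) :=
  rfl

/-- **Twist criterion for the presented `TLG` theory**: two identifications `g, g' : Λ(k̄ˣ) ≃* μ_Ẑ(G_k)` give the same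
class iff `g' = g` or `g' = g ≫ inv`. [cite: MochizukiAbsTopIII2015, Proposition 3.3 (i) p.73] -/
theorem mapCyclotome_cycIsoClass_eq_iff
    (g g' : Literature.AnabelianGeometry.EtaleTheta.cyclotome (π.C.K)ˣ ≃* muZhat (Field.absoluteGaloisGroup π.C.k)) :
    @Eq (Set (cyclotome P.M ≃* muZhat (Field.absoluteGaloisGroup π.C.k)))
        (π.unitKummerTheory.mapCyclotome g).cycIsoClass (π.unitKummerTheory.mapCyclotome g').cycIsoClass ↔
      (g' = g ∨ g' = g.trans (MulEquiv.inv (muZhat (Field.absoluteGaloisGroup π.C.k)))) :=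
  π.unitKummerTheory.mapCyclotome_cycIsoClass_eq_iff_of_TLG' g g'

/-- The junction built from the inverse twist `D'` of `D` is the junction built from `D`, POST-composed with inversion of
`μ_Ẑ(G_k)`. [cite: MochizukiAbsTopIII2015, Remark 3.2.1 p.73] -/
theorem junction_eq_trans_inv_of_inv_twist {D D' : TorsionReciprocityData π.C.k}
    (h : ∀ (U : OpenSubgroup (Field.absoluteGaloisGroup π.C.k))
      (x : abelianizationTorsion (U : Subgroup (Field.absoluteGaloisGroup π.C.k))), D'.θ U x = (D.θ U x)⁻¹) :
    (MonoidKummerTheory.cyclotomeCongr π.C.closureMulEquivAlgClosure).trans D'.muZhatEquiv.symm =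
      ((MonoidKummerTheory.cyclotomeCongr π.C.closureMulEquivAlgClosure).trans D.muZhatEquiv.symm).trans
        (MulEquiv.inv (muZhat (Field.absoluteGaloisGroup π.C.k))) := by
  rw [TorsionReciprocityData.muZhatEquiv_symm_eq_of_inv_twist h, MulEquiv.inv_trans_eq_trans_inv]
  rfl

/-- The junction built from a datum whose `Ẑ`-identification is `D.muZhatEquiv ≫ inv` is the junction built from `D`,
POST-composed with inversion. [cite: MochizukiAbsTopIII2015, Remark 3.2.1 p.73] -/
theorem junction_eq_trans_inv_of_muZhatEquiv_eq {D D' : TorsionReciprocityData π.C.k}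
    (h : D'.muZhatEquiv = D.muZhatEquiv.trans (MulEquiv.inv _)) :
    (MonoidKummerTheory.cyclotomeCongr π.C.closureMulEquivAlgClosure).trans D'.muZhatEquiv.symm =
      ((MonoidKummerTheory.cyclotomeCongr π.C.closureMulEquivAlgClosure).trans D.muZhatEquiv.symm).trans
        (MulEquiv.inv (muZhat (Field.absoluteGaloisGroup π.C.k))) := by
  rw [h, MulEquiv.trans_inv_symm, MulEquiv.inv_trans_eq_trans_inv]
  rfl

/-- **Two data related by the inverse twist give the SAME presented `TLG` class against `μ_Ẑ(G_k)`** (the `{±1}`-torsor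
absorbs exactly this). [cite: MochizukiAbsTopIII2015, Proposition 3.3 (i) p.73] -/
theorem mapCyclotome_cycIsoClass_eq_of_inv_twist {D D' : TorsionReciprocityData π.C.k}
    (h : ∀ (U : OpenSubgroup (Field.absoluteGaloisGroup π.C.k))
      (x : abelianizationTorsion (U : Subgroup (Field.absoluteGaloisGroup π.C.k))), D'.θ U x = (D.θ U x)⁻¹) :
    @Eq (Set (cyclotome P.M ≃* muZhat (Field.absoluteGaloisGroup π.C.k)))
      (π.unitKummerTheory.mapCyclotome
        ((MonoidKummerTheory.cyclotomeCongr π.C.closureMulEquivAlgClosure).trans D'.muZhatEquiv.symm)).cycIsoClass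
      (π.unitKummerTheory.mapCyclotome
        ((MonoidKummerTheory.cyclotomeCongr π.C.closureMulEquivAlgClosure).trans D.muZhatEquiv.symm)).cycIsoClass :=
  ((π.mapCyclotome_cycIsoClass_eq_iff _ _).mpr (Or.inr (π.junction_eq_trans_inv_of_inv_twist h))).symm

/-- **Consumer form for «RECIPROCITY-NORMALISE»**: two data that are EQUAL OR INVERSE-TWISTED on every `θ_U` give the
same presented `TLG` class — so any normalisation of the datum that is unique up to the inverse twist makes the `TLG`
junction choice-free. [cite: MochizukiAbsTopIII2015, Remark 3.2.1 p.73] -/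
theorem mapCyclotome_cycIsoClass_eq_of_θ_eq_or_inv {D D' : TorsionReciprocityData π.C.k}
    (h : (∀ (U : OpenSubgroup (Field.absoluteGaloisGroup π.C.k))
        (x : abelianizationTorsion (U : Subgroup (Field.absoluteGaloisGroup π.C.k))), D'.θ U x = D.θ U x) ∨
      (∀ (U : OpenSubgroup (Field.absoluteGaloisGroup π.C.k))
        (x : abelianizationTorsion (U : Subgroup (Field.absoluteGaloisGroup π.C.k))), D'.θ U x = (D.θ U x)⁻¹)) :
    @Eq (Set (cyclotome P.M ≃* muZhat (Field.absoluteGaloisGroup π.C.k)))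
      (π.unitKummerTheory.mapCyclotome
        ((MonoidKummerTheory.cyclotomeCongr π.C.closureMulEquivAlgClosure).trans D'.muZhatEquiv.symm)).cycIsoClass
      (π.unitKummerTheory.mapCyclotome
        ((MonoidKummerTheory.cyclotomeCongr π.C.closureMulEquivAlgClosure).trans D.muZhatEquiv.symm)).cycIsoClass := by
  rcases h with h | h
  · obtain rfl := TorsionReciprocityData.eq_of_θ_eq h
    rfl
  · exact π.mapCyclotome_cycIsoClass_eq_of_inv_twist h

/-- The same with the hypothesis at the `Ẑ`-level: `D'.muZhatEquiv = D.muZhatEquiv` or `= D.muZhatEquiv ≫ inv`.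
[cite: MochizukiAbsTopIII2015, Remark 3.2.1 p.73] -/
theorem mapCyclotome_cycIsoClass_eq_of_muZhatEquiv_eq_or {D D' : TorsionReciprocityData π.C.k}
    (h : D'.muZhatEquiv = D.muZhatEquiv ∨ D'.muZhatEquiv = D.muZhatEquiv.trans (MulEquiv.inv _)) :
    @Eq (Set (cyclotome P.M ≃* muZhat (Field.absoluteGaloisGroup π.C.k)))
      (π.unitKummerTheory.mapCyclotome
        ((MonoidKummerTheory.cyclotomeCongr π.C.closureMulEquivAlgClosure).trans D'.muZhatEquiv.symm)).cycIsoClass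
      (π.unitKummerTheory.mapCyclotome
        ((MonoidKummerTheory.cyclotomeCongr π.C.closureMulEquivAlgClosure).trans D.muZhatEquiv.symm)).cycIsoClass := by
  rcases h with h | h
  · exact ((π.mapCyclotome_cycIsoClass_eq_iff _ _).mpr (Or.inl (by rw [h]))).symm
  · exact ((π.mapCyclotome_cycIsoClass_eq_iff _ _).mpr (Or.inr (π.junction_eq_trans_inv_of_muZhatEquiv_eq h))).symm

/-- Junction algebra: `c ≫ D.symm = c ≫ D₀.symm ↔ D.muZhatEquiv = D₀.muZhatEquiv`.
[cite: MochizukiAbsTopIII2015, Remark 3.2.1 p.73] -/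
theorem junction_eq_iff (D D₀ : TorsionReciprocityData π.C.k) :
    (MonoidKummerTheory.cyclotomeCongr π.C.closureMulEquivAlgClosure).trans D.muZhatEquiv.symm =
        (MonoidKummerTheory.cyclotomeCongr π.C.closureMulEquivAlgClosure).trans D₀.muZhatEquiv.symm ↔
      D.muZhatEquiv = D₀.muZhatEquiv :=
  (MulEquiv.trans_cancel_left _).trans MulEquiv.symm_inj_iff

/-- Junction algebra: `c ≫ D.symm = (c ≫ D₀.symm) ≫ inv ↔ D.muZhatEquiv = D₀.muZhatEquiv ≫ inv`.
[cite: MochizukiAbsTopIII2015, Remark 3.2.1 p.73] -/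
theorem junction_eq_trans_inv_iff (D D₀ : TorsionReciprocityData π.C.k) :
    (MonoidKummerTheory.cyclotomeCongr π.C.closureMulEquivAlgClosure).trans D.muZhatEquiv.symm =
        ((MonoidKummerTheory.cyclotomeCongr π.C.closureMulEquivAlgClosure).trans D₀.muZhatEquiv.symm).trans
          (MulEquiv.inv (muZhat (Field.absoluteGaloisGroup π.C.k))) ↔
      D.muZhatEquiv = D₀.muZhatEquiv.trans (MulEquiv.inv _) := by
  have e : ((MonoidKummerTheory.cyclotomeCongr π.C.closureMulEquivAlgClosure).trans D₀.muZhatEquiv.symm).trans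
        (MulEquiv.inv (muZhat (Field.absoluteGaloisGroup π.C.k))) =
      (MonoidKummerTheory.cyclotomeCongr π.C.closureMulEquivAlgClosure).trans
        (D₀.muZhatEquiv.trans (MulEquiv.inv _)).symm := by
    rw [MulEquiv.trans_inv_symm, MulEquiv.inv_trans_eq_trans_inv]
    rfl
  rw [e]
  exact (MulEquiv.trans_cancel_left _).trans MulEquiv.symm_inj_iff

/-- **The typed residual of clause (c) for `TLG`, exactly**: the class of `π.unitKummerTheoryMuZhat` (chosen datum
`D₀ = π.C.reciprocityData`) coincides with the class built from a datum `D` IF AND ONLY IF `D.muZhatEquiv = D₀.muZhatEquiv`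
or `D.muZhatEquiv = D₀.muZhatEquiv ≫ inv`.  So the presented `TLG` junction is print's «natural isomorphism … up to `{±1}`»
precisely when the chosen datum is the Rmk. 3.2.1-normalised one up to the inverse twist — and for no weaker reason.
[cite: MochizukiAbsTopIII2015, Proposition 3.3 (i) p.73] -/
theorem unitKummerTheoryMuZhat_cycIsoClass_eq_iff (D : TorsionReciprocityData π.C.k) :
    @Eq (Set (cyclotome P.M ≃* muZhat (Field.absoluteGaloisGroup π.C.k)))
        π.unitKummerTheoryMuZhat.cycIsoClass
        (π.unitKummerTheory.mapCyclotome
          ((MonoidKummerTheory.cyclotomeCongr π.C.closureMulEquivAlgClosure).trans D.muZhatEquiv.symm)).cycIsoClass ↔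
      (D.muZhatEquiv = π.C.reciprocityData.muZhatEquiv ∨
        D.muZhatEquiv = π.C.reciprocityData.muZhatEquiv.trans (MulEquiv.inv _)) :=
  (π.mapCyclotome_cycIsoClass_eq_iff _ _).trans
    (or_congr (π.junction_eq_iff D π.C.reciprocityData) (π.junction_eq_trans_inv_iff D π.C.reciprocityData))

/-- Hence: a datum `D` whose `Ẑ`-identification is NEITHER the chosen one NOR its inverse twist gives a DIFFERENT presented
`TLG` class (the `TLG` junction genuinely depends on the datum modulo `±1` — the content the Rmk. 3.2.1 normalisation
supplies). [cite: MochizukiAbsTopIII2015, Proposition 3.3 (i) p.73] -/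
theorem unitKummerTheoryMuZhat_cycIsoClass_ne (D : TorsionReciprocityData π.C.k)
    (h₁ : D.muZhatEquiv ≠ π.C.reciprocityData.muZhatEquiv)
    (h₂ : D.muZhatEquiv ≠ π.C.reciprocityData.muZhatEquiv.trans (MulEquiv.inv _)) :
    ¬ @Eq (Set (cyclotome P.M ≃* muZhat (Field.absoluteGaloisGroup π.C.k)))
        π.unitKummerTheoryMuZhat.cycIsoClass
        (π.unitKummerTheory.mapCyclotome
          ((MonoidKummerTheory.cyclotomeCongr π.C.closureMulEquivAlgClosure).trans D.muZhatEquiv.symm)).cycIsoClass :=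
  fun h => ((π.unitKummerTheoryMuZhat_cycIsoClass_eq_iff D).mp h).elim h₁ h₂

end GaloisMonoidPair.TLGPresentation

end Literature.AnabelianGeometry.AbsoluteAnabelian

end
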